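import Summits.RiemannHypothesis.RiemannHypothesis.Theorems.WeilTwoPrimeDeflC83XBase
import Summits.RiemannHypothesis.RiemannHypothesis.Theorems.WeilTwoPrimeDeflC83XDef
import Literature.NumberTheory.LFunctions.WeilTwoPrimeCellsT120CheckAll
import Summits.RiemannHypothesis.RiemannHypothesis.Theorems.GroundBartaEvenWinsBeyondArchPhantomCertificateDeflated
import Summits.RiemannHypothesis.RiemannHypothesis.Theorems.GroundBartaEvenWinsBeyondArchPhantomXT120OK
import Summits.RiemannHypothesis.RiemannHypothesis.Theorems.GroundBartaEvenWinsBeyondArchPhantomXT120Lev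
import HarnessLib

/-!
# Deflated phantom two-prime certificate C83X: assembly of the checks and the certified complement level at window `83/100` — part `CertLev` (the block-independent facts: ψ-chain, phantom chain, ripple admissibility, tail level, parameters; split of `Cert` by prover B g8 so that each sector's bound assembles from its own block — `CertO` / `CertE`)

Import-independent part of the certificate assembly (split for the build: each part imports only the row modules it cites). Pure proof file.
-/

set_option linter.dupNamespace false

noncomputable section

namespace Summit.RiemannHypothesis.RiemannHypothesis.Theorems.EvenWinsBeyondArch

open Literature.NumberTheory.LFunctions

/-- **The ψ-chain of certificate C83X is valid** (`CellsOK₂₃` of the landed chain on `[0, 120]` at the low level). [folklore] -/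
theorem cellsOK_weilCertDeflC83X : CellsOK₂₃ weilCertDeflC83X.base.wL weilCertDeflC83X.base.T weilCertDeflC83X.cells :=
  cellsOK_weilTwoPrimeCellsT120

/-- **The phantom chain of certificate C83X is valid** (`XCellsOK` of `xt120Cells`, rh-explicit-weil-1). [folklore] -/
theorem xOK_weilCertDeflC83X : XCellsOK weilCertDeflC83X.rs weilCertDeflC83X.base.T weilCertDeflC83X.xcells :=
  xCellsOK_xt120

set_option maxHeartbeats 0 in
/-- Admissibility of the phantom for the window `b = 83/100`: every ripple frequency enclosure has `2b ≤ xlo` (kernel). [folklore] -/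
theorem rip_weilCertDeflC83X : weilCertDeflC83X.checkRipples = true := by
  decide +kernel

/-- **The boosted tail level** `269/100 ≤ w₂₃(t) + P(t)` for `|t| ≥ 120` (kernel level certificate `xt120Level`, rh-explicit-weil-1). [folklore] -/
theorem level_weilCertDeflC83X : ∀ t : ℝ, (weilCertDeflC83X.base.T : ℝ) ≤ |t| → (weilCertDeflC83X.wL : ℝ) ≤ weilTwoPrimeWeight t + ripplesVal weilCertDeflC83X.rs t :=
  fun t ht ↦ xt120Level t ht

/-- The parameters of certificate C83X as literals: `N + 1 = 272`, `a₀ = 83/100`. [folklore] -/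
theorem params_weilCertDeflC83X : weilCertDeflC83X.base.N + 1 = 272 ∧ ((weilCertDeflC83X.base.a0 : ℚ) : ℝ) = (83/100 : ℝ) := by
  refine ⟨rfl, ?_⟩
  show (((83/100 : ℚ)) : ℝ) = _; norm_num

end Summit.RiemannHypothesis.RiemannHypothesis.Theorems.EvenWinsBeyondArch
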